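import Summits.BirchSwinnertonDyer.BirchSwinnertonDyer.Theorems.ManinLocalTwoThreeShimuraRationalTwoTorsionAnyModel
import Summits.BirchSwinnertonDyer.BirchSwinnertonDyer.Theorems.ManinLocalTwoThreeShimuraQuotientLevelInstances
import HarnessLib

/-!
# An optimal curve WITHOUT rational `2`-torsion IS Stevens' curve at the index-`4`-free levels `N = 8p, 16p, 32, 64, 128, 256, u²v (uv = 4q)`
Summit `BirchSwinnertonDyer`, route `ManinLocalTwoThree` (cell bsd-f2-manin), deciding crux C2 `ManinOddAtFour` (stmt-BirchSwinnertonDyer-22967);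
lead p1 gen 15.  The tree's Shimura trichotomy at `4 ∣ N` (`trichotomy_shimura_of_four_dvd_level_anyModel`, p2: `Λ₁(f) = Λ₀(f)` ∨
`Λ₁(f) = 2Λ₀(f)` ∨ `W₀.Ψ₂Sq` has a rational root) loses its middle branch wherever index `4` is excluded by the LEVEL (cuspidal-inertia
reduction, `…ShimuraQuotientLevelInstances`): the tree had this at `N = 4q` only (`stevens_eq_optimal_of_no_Ψ₂Sq_root_four_mul`).
* `stevens_eq_optimal_of_no_Ψ₂Sq_root_of_generator_mod` — `N = u²v`, `4 ∣ N`, units of `ℤ/uv` of the form `± u₀^k`: for the optimal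
  `X₁(N)`/`X₀(N)` pair of a class whose optimal curve `W₀` has NO rational root of `Ψ₂Sq` (no rational `2`-torsion):
  `Λ₁(f) = Λ₀(f)` and `|c₀| = |c₁|` — unconditionally;
* `…_eight_mul_prime`, `…_sixteen_mul_prime` (`N = 8p, 16p`, `p` odd prime), `…_two_power` (`N ∈ {32, 64, 128, 256}`);
* dichotomies `periodLatticeGamma1_eq_or_exists_Ψ₂Sq_root_…` and the divisor forms `dvd_maninConstant₀_iff_of_no_Ψ₂Sq_root_…`
  (`ℓ ∣ c₀ ⟺ ℓ ∣ c₁`, so C2 for `D₀` ⟺ C2¹ for the Stevens datum on this locus).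
HONEST FRAMING: unconditional transfer statements on the locus «no rational `2`-torsion»; which Manin constant is odd stays OPEN (Stevens I);
C2, Manin's conjecture and BSD are NOT proved.  No definitions, no sorry.
[cite: Stevens1989, §2] [cite: LingOesterle1991, Thm. 1 and Thm. 6]
-/

set_option autoImplicit false
-- the summit-side namespace `Summit.BirchSwinnertonDyer.BirchSwinnertonDyer.…` is the tree's (summit = sub-problem)
set_option linter.dupNamespace false

noncomputable section

open scoped Classical

open WeierstrassCurve Literature.NumberTheory.EllipticCurves Literature.NumberTheory.EllipticCurves.ModularForms
open CongruenceSubgroup Polynomial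

namespace Summit.BirchSwinnertonDyer.BirchSwinnertonDyer.Theorems.ManinLocalTwoThree

variable {W₁ W₀ : WeierstrassCurve ℚ} [W₁.IsElliptic] [W₁.IsGloballyMinimal] [W₀.IsElliptic]
  [W₀.IsGloballyMinimal] {N : ℕ} [NeZero N]

/-- **No rational `Ψ₂Sq` root ⟹ Stevens' curve is the optimal curve, at every index-`4`-free level** (`N = u²v`, `4 ∣ N`, units of
`ℤ/uv` of the form `± u₀^k`): `Λ₁(f) = Λ₀(f)` and `|c₀| = |c₁|`. [cite: Stevens1989, §2] [cite: LingOesterle1991, Thm. 1 and Thm. 6] -/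
theorem stevens_eq_optimal_of_no_Ψ₂Sq_root_of_generator_mod {u v m : ℕ} (hu : u ≠ 0)
    (hN : (N : ℤ) = (u : ℤ) ^ 2 * v) (hm : u * v = m) {u₀ : ZMod m} (hu₀ : IsUnit u₀)
    (hgen : ∀ w : (ZMod m)ˣ, ∃ k : ℕ, (w : ZMod m) = u₀ ^ k ∨ (w : ZMod m) = -(u₀ ^ k))
    (D₁ : Gamma1ParametrizationData W₁ N) (D₀ : ModularParametrizationData W₀ N) (hiso : IsIsogenous W₁ W₀)
    (h₁ : D₁.IsOptimal) (h₀ : ∀ z ∈ D₀.L.lattice, ∃ w ∈ periodLattice D₀.f, z = D₀.c * w) (h4 : 2 ^ 2 ∣ N)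
    (hno : ∀ x : ℚ, W₀.Ψ₂Sq.eval x ≠ 0) :
    periodLatticeGamma1 D₀.f = periodLattice D₀.f ∧ D₀.maninConstant.natAbs = D₁.maninConstant.natAbs := by
  have hf : D₁.f = D₀.f := D₁.f_eq_of_isIsogenous D₀ hiso
  rcases trichotomy_shimura_of_four_dvd_level_anyModel D₁ D₀ hiso h₁ h₀ h4 with h | h | ⟨x, hx⟩
  · exact ⟨h, natAbs_maninConstant₀_eq_of_periodLatticeGamma1_eq_periodLattice D₁ D₀ h₁ h₀ hf h⟩
  · exact absurd h (not_periodLatticeGamma1_eq_two_mul_of_generator_mod hu hN hm hu₀ hgen D₀ h₀ h4)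
  · exact absurd hx (hno x)

/-- **`N = 8p` (`p` odd prime): no rational `Ψ₂Sq` root ⟹ `Λ₁(f) = Λ₀(f)` and `|c₀| = |c₁|`.** [cite: Stevens1989, §2] -/
theorem stevens_eq_optimal_of_no_Ψ₂Sq_root_eight_mul_prime {p : ℕ} (hp : p.Prime) (hp2 : p ≠ 2) [NeZero (8 * p)]
    (D₁ : Gamma1ParametrizationData W₁ (8 * p)) (D₀ : ModularParametrizationData W₀ (8 * p))
    (hiso : IsIsogenous W₁ W₀) (h₁ : D₁.IsOptimal)
    (h₀ : ∀ z ∈ D₀.L.lattice, ∃ w ∈ periodLattice D₀.f, z = D₀.c * w) (hno : ∀ x : ℚ, W₀.Ψ₂Sq.eval x ≠ 0) :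
    periodLatticeGamma1 D₀.f = periodLattice D₀.f ∧ D₀.maninConstant.natAbs = D₁.maninConstant.natAbs := by
  have hf : D₁.f = D₀.f := D₁.f_eq_of_isIsogenous D₀ hiso
  rcases trichotomy_shimura_of_four_dvd_level_anyModel D₁ D₀ hiso h₁ h₀ ⟨2 * p, by ring⟩ with h | h | ⟨x, hx⟩
  · exact ⟨h, natAbs_maninConstant₀_eq_of_periodLatticeGamma1_eq_periodLattice D₁ D₀ h₁ h₀ hf h⟩
  · exact absurd h (not_periodLatticeGamma1_eq_two_mul_eight_mul_prime hp hp2 D₀ h₀)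
  · exact absurd hx (hno x)

/-- **`N = 16p` (`p` odd prime): no rational `Ψ₂Sq` root ⟹ `Λ₁(f) = Λ₀(f)` and `|c₀| = |c₁|`.** [cite: Stevens1989, §2] -/
theorem stevens_eq_optimal_of_no_Ψ₂Sq_root_sixteen_mul_prime {p : ℕ} (hp : p.Prime) (hp2 : p ≠ 2) [NeZero (16 * p)]
    (D₁ : Gamma1ParametrizationData W₁ (16 * p)) (D₀ : ModularParametrizationData W₀ (16 * p))
    (hiso : IsIsogenous W₁ W₀) (h₁ : D₁.IsOptimal)
    (h₀ : ∀ z ∈ D₀.L.lattice, ∃ w ∈ periodLattice D₀.f, z = D₀.c * w) (hno : ∀ x : ℚ, W₀.Ψ₂Sq.eval x ≠ 0) :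
    periodLatticeGamma1 D₀.f = periodLattice D₀.f ∧ D₀.maninConstant.natAbs = D₁.maninConstant.natAbs := by
  have hf : D₁.f = D₀.f := D₁.f_eq_of_isIsogenous D₀ hiso
  rcases trichotomy_shimura_of_four_dvd_level_anyModel D₁ D₀ hiso h₁ h₀ ⟨4 * p, by ring⟩ with h | h | ⟨x, hx⟩
  · exact ⟨h, natAbs_maninConstant₀_eq_of_periodLatticeGamma1_eq_periodLattice D₁ D₀ h₁ h₀ hf h⟩
  · exact absurd h (not_periodLatticeGamma1_eq_two_mul_sixteen_mul_prime hp hp2 D₀ h₀)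
  · exact absurd hx (hno x)

/-- **`N ∈ {32, 64, 128, 256}`: no rational `Ψ₂Sq` root ⟹ `Λ₁(f) = Λ₀(f)` and `|c₀| = |c₁|`.** [cite: Stevens1989, §2] -/
theorem stevens_eq_optimal_of_no_Ψ₂Sq_root_two_power (hN : N = 32 ∨ N = 64 ∨ N = 128 ∨ N = 256)
    (D₁ : Gamma1ParametrizationData W₁ N) (D₀ : ModularParametrizationData W₀ N)
    (hiso : IsIsogenous W₁ W₀) (h₁ : D₁.IsOptimal)
    (h₀ : ∀ z ∈ D₀.L.lattice, ∃ w ∈ periodLattice D₀.f, z = D₀.c * w) (hno : ∀ x : ℚ, W₀.Ψ₂Sq.eval x ≠ 0) :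
    periodLatticeGamma1 D₀.f = periodLattice D₀.f ∧ D₀.maninConstant.natAbs = D₁.maninConstant.natAbs := by
  have hf : D₁.f = D₀.f := D₁.f_eq_of_isIsogenous D₀ hiso
  have h4 : 2 ^ 2 ∣ N := by rcases hN with rfl | rfl | rfl | rfl <;> norm_num
  rcases trichotomy_shimura_of_four_dvd_level_anyModel D₁ D₀ hiso h₁ h₀ h4 with h | h | ⟨x, hx⟩
  · exact ⟨h, natAbs_maninConstant₀_eq_of_periodLatticeGamma1_eq_periodLattice D₁ D₀ h₁ h₀ hf h⟩
  · exact absurd h (not_periodLatticeGamma1_eq_two_mul_of_two_power hN D₀ h₀)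
  · exact absurd hx (hno x)

/-- **DICHOTOMY at the index-`4`-free levels** (`N = u²v`, `4 ∣ N`, units of `ℤ/uv` `= ± u₀^k`): `Λ₁(f) = Λ₀(f) ∧ |c₀| = |c₁|`, or
`W₀.Ψ₂Sq` has a rational root. [cite: Stevens1989, §2] -/
theorem periodLatticeGamma1_eq_or_exists_Ψ₂Sq_root_of_generator_mod {u v m : ℕ} (hu : u ≠ 0)
    (hN : (N : ℤ) = (u : ℤ) ^ 2 * v) (hm : u * v = m) {u₀ : ZMod m} (hu₀ : IsUnit u₀)
    (hgen : ∀ w : (ZMod m)ˣ, ∃ k : ℕ, (w : ZMod m) = u₀ ^ k ∨ (w : ZMod m) = -(u₀ ^ k))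
    (D₁ : Gamma1ParametrizationData W₁ N) (D₀ : ModularParametrizationData W₀ N) (hiso : IsIsogenous W₁ W₀)
    (h₁ : D₁.IsOptimal) (h₀ : ∀ z ∈ D₀.L.lattice, ∃ w ∈ periodLattice D₀.f, z = D₀.c * w) (h4 : 2 ^ 2 ∣ N) :
    (periodLatticeGamma1 D₀.f = periodLattice D₀.f ∧ D₀.maninConstant.natAbs = D₁.maninConstant.natAbs) ∨
      ∃ x : ℚ, W₀.Ψ₂Sq.eval x = 0 := by
  by_cases hno : ∃ x : ℚ, W₀.Ψ₂Sq.eval x = 0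
  · exact Or.inr hno
  · exact Or.inl (stevens_eq_optimal_of_no_Ψ₂Sq_root_of_generator_mod hu hN hm hu₀ hgen D₁ D₀ hiso h₁ h₀ h4
      fun x hx ↦ hno ⟨x, hx⟩)

/-- Divisor form at the index-`4`-free levels: without a rational `Ψ₂Sq` root, `ℓ ∣ c₀ ⟺ ℓ ∣ c₁` for every integer `ℓ`
(so C2 for `D₀` ⟺ C2¹ for the Stevens datum). [cite: Stevens1989, §2] -/
theorem dvd_maninConstant₀_iff_of_no_Ψ₂Sq_root_of_generator_mod {u v m : ℕ} (hu : u ≠ 0)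
    (hN : (N : ℤ) = (u : ℤ) ^ 2 * v) (hm : u * v = m) {u₀ : ZMod m} (hu₀ : IsUnit u₀)
    (hgen : ∀ w : (ZMod m)ˣ, ∃ k : ℕ, (w : ZMod m) = u₀ ^ k ∨ (w : ZMod m) = -(u₀ ^ k))
    (D₁ : Gamma1ParametrizationData W₁ N) (D₀ : ModularParametrizationData W₀ N) (hiso : IsIsogenous W₁ W₀)
    (h₁ : D₁.IsOptimal) (h₀ : ∀ z ∈ D₀.L.lattice, ∃ w ∈ periodLattice D₀.f, z = D₀.c * w) (h4 : 2 ^ 2 ∣ N)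
    (hno : ∀ x : ℚ, W₀.Ψ₂Sq.eval x ≠ 0) (ℓ : ℤ) : ℓ ∣ D₀.maninConstant ↔ ℓ ∣ D₁.maninConstant := by
  have heq := (stevens_eq_optimal_of_no_Ψ₂Sq_root_of_generator_mod hu hN hm hu₀ hgen D₁ D₀ hiso h₁ h₀ h4 hno).2
  rw [← Int.natAbs_dvd_natAbs, ← Int.natAbs_dvd_natAbs (b := D₁.maninConstant), heq]

/-- Divisor form at `N = 8p` / `16p` / `2^e ∈ {32, 64, 128, 256}`: without a rational `Ψ₂Sq` root, `ℓ ∣ c₀ ⟺ ℓ ∣ c₁`.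
[cite: Stevens1989, §2] -/
theorem dvd_maninConstant₀_iff_of_no_Ψ₂Sq_root_reducedLevels
    (hN : (∃ p : ℕ, p.Prime ∧ p ≠ 2 ∧ (N = 8 * p ∨ N = 16 * p)) ∨ (N = 32 ∨ N = 64 ∨ N = 128 ∨ N = 256))
    (D₁ : Gamma1ParametrizationData W₁ N) (D₀ : ModularParametrizationData W₀ N) (hiso : IsIsogenous W₁ W₀)
    (h₁ : D₁.IsOptimal) (h₀ : ∀ z ∈ D₀.L.lattice, ∃ w ∈ periodLattice D₀.f, z = D₀.c * w)
    (hno : ∀ x : ℚ, W₀.Ψ₂Sq.eval x ≠ 0) (ℓ : ℤ) : ℓ ∣ D₀.maninConstant ↔ ℓ ∣ D₁.maninConstant := by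
  have heq : D₀.maninConstant.natAbs = D₁.maninConstant.natAbs := by
    rcases hN with ⟨p, hp, hp2, rfl | rfl⟩ | h2
    · exact (stevens_eq_optimal_of_no_Ψ₂Sq_root_eight_mul_prime hp hp2 D₁ D₀ hiso h₁ h₀ hno).2
    · exact (stevens_eq_optimal_of_no_Ψ₂Sq_root_sixteen_mul_prime hp hp2 D₁ D₀ hiso h₁ h₀ hno).2
    · exact (stevens_eq_optimal_of_no_Ψ₂Sq_root_two_power h2 D₁ D₀ hiso h₁ h₀ hno).2
  rw [← Int.natAbs_dvd_natAbs, ← Int.natAbs_dvd_natAbs (b := D₁.maninConstant), heq]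

end Summit.BirchSwinnertonDyer.BirchSwinnertonDyer.Theorems.ManinLocalTwoThree

end
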